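import Summits.CriticalPhenomena.PercolationContinuityZ3.Theorems.Transplant.SkelPhiRootLegBridgeKGV
import Summits.CriticalPhenomena.PercolationContinuityZ3.Theorems.Transplant.SkelPhiRootBridgeKitsFCQ
import Summits.CriticalPhenomena.PercolationContinuityZ3.Theorems.Transplant.SkelPhiCorridorStepsFCQ
import Summits.CriticalPhenomena.PercolationContinuityZ3.Theorems.Transplant.SkelPhiRunQStepsQ
import HarnessLib

/-!
# Quasi-step rung (N3-b), BINDER WAVE, row Q53 «SkelPhiRootLegBridgeKGV» of WAVE-Q-BINDER-rows v0.9 under (ι) := `Skelφ.QStepsN G φ M`: **THE ROOT LEG OF RECORD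
# (hop → bridge → corridor)** when the base chart has only exact-footprint quasi-steps of cost `M` — **`rootChainF_of_bridgeSchedCV_q`**, the twin of
# «SkelPhiRootLegBridgeKGV» `rootChainF_of_bridgeSchedCV` (which assumed `Steps G φ`)

builds on p205010 (kernel theorem, internal audit signed; external expert review pending) — nothing in this file uses p205010; nothing here is a claim about any open node
((N3-b), the end state); no carrier, no node, no definition.  Lane `prim-bschramm`, seat `prim-hp-8` (gen 62; binder-wave pen, family Forced*/Root*/RunKits/ApronKitDefs —
captain gen-1 g4, lane INBOX 2026-08-27 07:25Z).  thm row; FLOORS (two kits): bridge kit `hPNb : 1 ≤ Pb.N ↦ M ≤ Pb.N`, `KCmaxb ↦ Pb.N·KCmaxb` in `hDwb`/`hTb`/`hr₀b`/`hrsb`/`hEb`/`hreachb`,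
`KCmaxb + 1 ↦ (KCmaxb+1)(Pb.N+2)` in `hcSb`; corridor kit `hPN : kq + 3 ≤ Pk.N ↦ M·(kq+3) ≤ Pk.N`, `KCmax ↦ Pk.N·KCmax` in `hT`/`hr₀`/`hrs`/`hreach`/`hE`, `KCmax + 1 ↦ (KCmax+1)(Pk.N+2)`
in `hcS`; depth row `hRdepth : D₀ + (kq+3)·‖z‖₁ ≤ Rπ ↦ D₀ + M·(kq+3)·‖z‖₁ ≤ Rπ` (the run frame's column device, α5).  Helper file (`--supports stmt-CriticalPhenomena-4575 --as helper`).
WHY (hunk classes (i) binder `(hstep : Steps G φ) ↦ {M : ℕ} (hqφ : QStepsN G φ M)`; (ii) call sites `qStepsN_runX hstep ↦ qStepsN_runX_of_qStepsN hqφ` («SkelPhiRunQStepsQ»),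
`hkits_bridgeFC ↦ hkits_bridgeFC_q` («SkelPhiRootBridgeKitsFCQ» Q41), `hkits_schedFC ↦ hkits_schedFCQ` (stmt-g33's «SkelPhiCorridorStepsFCQ» Q45); (iv) floors as above).  Proof
otherwise byte-identical.  Regression: `qStepsN_of_steps` (`M = 1`).
* **`rootChainF_of_bridgeSchedCV_q`**.
[cite: KozmaNitzan2024, §4 p. 28 ((32) at the root), Lemma 10 (pp. 17–21), Lemma 12 (pp. 23–25)] [cite: MartineauTassion2017, §4.3 Lemma 4.2]
-/

noncomputable section

open MeasureTheory ProbabilityTheory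
open scoped ENNReal Classical

namespace Summit.CriticalPhenomena.PercolationContinuityZ3.Theorems

namespace Transplant

namespace Skelφ

open Literature.Probability.Percolation Literature.Probability.LatticeModels SimpleGraph GadgetSystem ProbeHistory HSiteScheme Contour KNCells
open Literature.Probability.Percolation.KozmaNitzan.Cells (oth sgOf stepVec_apply_fst)
open KNCells.KSchA KNLevels ChainPlanar ChainPara
open Literature.Barriers.CriticalPhenomena (graphBall mem_graphBall_self graphBall_mono)
open BoxProdZ2 (ConcRadiiG)
open Skel (winGraph)
open SkelI (tanOff)

variable {V : Type} [DecidableEq V] [Countable V] {G : SimpleGraph V} [G.LocallyFinite] {φ ψc : V → Site 2}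

/-- **THE ROOT LEG OF RECORD (hop → bridge → corridor), analytic hypotheses discharged** (see the module docstring): for the scheme
`⟨cellGeomSG₂bV G ψc P t Λ b₀, q, δc⟩` (root `t` by `rfl`) and a direction `du`, the `RootOblTWF` body at accuracy `δ` with `0 + 1 + Sc.N + 1` steps.
[cite: KozmaNitzan2024, §4 p. 28 ((32) at the root), Lemma 10 (pp. 17–21), Lemma 12 (pp. 23–25)] -/
theorem rootChainF_of_bridgeSchedCV_q (hlipφ : Lip G φ) {M : ℕ} (hqφ : QStepsN G φ M) {Δ : ℕ} (hΔ : ∀ v, G.degree v ≤ Δ)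
    (hlipc : Lip G ψc) (hwsc : WeakSteps G ψc)
    -- the cells, the root, the direction, the root frame's sign, the window radius below the concentric radii
    (P : PCells2V) (t : V) (Λ : ConcRadiiG) (b₀ : Fin 2 → ℕ) (q : unitInterval) (δc : ℝ) (du : MDir) {σ : ℤ} (hσ : σ = 1 ∨ σ = -1)
    {Rπ : ℕ} (hRQ : Rπ + 1 ≤ Λ.rQ 0 0) (hRB : Rπ + 1 ≤ Λ.rB 0 0 du) (hRQ' : Rπ + 1 ≤ Λ.rQ 0 ((0 : Site 2) + stepVec du))
    (hRM : Rπ + 1 ≤ Λ.rM 0 ((0 : Site 2) + stepVec du))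
    -- the short region and the zone datum at every centre; THE SEED := the zone at the root (its footprint, its depth, its along-coordinate bound)
    (Rg : V → Finset V) {Rs cU : ℕ} (hRg : ∀ c, ∀ u ∈ Rg c, u ∈ graphBall G c Rs) (hRgcard : ∀ c, (Rg c).card ≤ cU) (hcU1 : 1 ≤ cU)
    (Λc : V → ℕ → Finset V) (kz : ℕ) (hΛRg : ∀ c, Λc c kz ⊆ Rg c) (hzconn : ∀ c, ∀ s ∈ Λc c kz, PathIn G (↑(Λc c kz) : Set V) c s)
    (hcz : ∀ c, c ∈ Λc c kz)
    {ρ : ℕ} (hZρ : ∀ a ∈ Λc t kz, a ∈ graphBall G t ρ) (hρπ : ρ ≤ Rπ)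
    (hZfoot : ∀ a ∈ Λc t kz, -(5 * (P.r du.1 : ℤ)) + 1 ≤ sgOf du * ψc a du.1 ∧ sgOf du * ψc a du.1 ≤ 5 * (P.r du.1 : ℤ) ∧
      |ψc a (oth du.1)| ≤ 5 * (P.r (oth du.1) : ℤ) - 1)
    {kb : ℕ} (hZk : ∀ a ∈ Λc t kz, |rootFrame φ t σ a 0| ≤ kb)
    -- THE BRIDGE: N1's bridge frame, the bridge kit `Pb` and its slot rows (hp-8's `hkits_bridgeFC`), the stride readings, level data, budget
    (B : BridgePrm) (hB : BridgeOK B)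
    (Pb : ApronPrm) {Mz KCmaxb rsb cSb : ℕ} (hPNb : M ≤ Pb.N) (hAb : Pb.A = (Mz : ℤ) + 2)
    (hdDb : Pb.d + 2 ≤ shellD Pb) (hDρb : Rs + 1 ≤ shellD Pb) (hKCmaxb : shellD Pb + Mz + 1 ≤ KCmaxb)
    {Rlev₁ N₁ j₀₁ j₁₁ : ℕ} (hRl₁ : Rlev₁ + 1 ≤ B.R') (hj₁ : j₁₁ ≤ Rlev₁)
    (hwideb : ∀ j, j₀₁ ≤ j → j ≤ j₁₁ → ∀ i, (B.B₀lo - (j : Site 2)) i + 2 * tanOff Pb.ℓs Pb.M ≤ (B.B₀hi + (j : Site 2)) i)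
    (hdwb : ∀ j, j₀₁ ≤ j → j ≤ j₁₁ → ∀ i, (B.B₀lo - (j : Site 2)) i + (Pb.d + 2 : ℕ) ≤ (B.B₀hi + (j : Site 2)) i)
    (hDwb : ∀ j, j₀₁ ≤ j → j ≤ j₁₁ → ∀ i, (B.B₀lo - (j : Site 2)) i + ((shellD Pb + 1 + Pb.d + Pb.N * KCmaxb + Rs : ℕ) : ℤ) ≤ (B.B₀hi + (j : Site 2)) i)
    (hTb : (shellD Pb : ℤ) + Pb.N * KCmaxb + Rs ≤ tanOff Pb.ℓs Pb.M)
    (hr₀b : Pb.N * (tanOff Pb.ℓs Pb.M + 2) + Pb.N * Pb.d + (Pb.N * KCmaxb + Rs) ≤ Pb.r₀) (hRb₀ : Pb.r₀ ≤ Rπ)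
    (hrsb : 1 + (Pb.N * (tanOff Pb.ℓs Pb.M + 2) + Pb.N * Pb.d + (Pb.N * KCmaxb + Rs)) ≤ rsb)
    (hcSb : (Pb.N + 1) * (tanOff Pb.ℓs Pb.M + 1) + (Pb.N + 1) * Pb.d + (KCmaxb + 1) * (Pb.N + 2) + cU ≤ cSb)
    (hEb : j₁₁ + (Pb.N * (tanOff Pb.ℓs Pb.M + 1) + Pb.N * Pb.d + Pb.N * KCmaxb) ≤ B.R')
    {rb Rb : ℕ} (hreachb : rb + (Pb.N * (tanOff Pb.ℓs Pb.M + 1) + Pb.N * Pb.d + Pb.N * KCmaxb) ≤ Pb.r₀) (hrb : Rb ≤ rb) (hrbR : rb ≤ Rπ)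
    (Qb Fb : V → Finset V)
    (hQb : ∀ c, ∀ w ∈ Qb c, w ∈ graphBall G c Rb ∧
      rootFrame φ t σ w ∈ Finset.Icc (rootFrame φ t σ c - ((B.pr : ℕ) : Site 2)) (rootFrame φ t σ c + ((B.pr : ℕ) : Site 2)))
    (hFb : ∀ c, ∀ w ∈ Fb c, w ∈ Qb c ∧ rootFrame φ t σ w ∈ Finset.Icc (rootFrame φ t σ c + B.dlo) (rootFrame φ t σ c + B.dhi))
    (kk₁ : ℕ) (hkN₁ : kk₁ * (Δ + 1) ^ (2 * rsb) ≤ N₁)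
    -- THE CORRIDOR: the run frame at `c₁`, ANY planar schedule `Sc`, the run kit `Pk` and its slot rows (p5-g16's `hkits_schedFC`), level data, budget,
    -- the depth row (origin depth `D₀`, one radius row over the prism)
    {n : ℕ} {hs : ℤ} (hn : 1 ≤ n) (c₁ : V) {σ₂ : ℤ} (hσ₂ : σ₂ = 1 ∨ σ₂ = -1) {kq : ℕ} (hκL : hs.natAbs ≤ kq * n)
    (Sc : ScheduleNP) {r : ℕ}
    (Pk : ApronPrm) {KCmax rs cS : ℕ} (hPN : M * (kq + 3) ≤ Pk.N) (hA : Pk.A = (Mz + 1 : ℕ) * (shearUnit n hs : ℤ) + 1)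
    (hdD : Pk.d + 2 ≤ shellD Pk) (hDρ : Rs + 1 ≤ shellD Pk) (hKCmax : (shellD Pk + Mz + 1) * (kq + 1) ≤ KCmax)
    (hT : (shellD Pk : ℤ) + Pk.N * KCmax + Rs ≤ tanOff Pk.ℓs Pk.M)
    (hr₀ : Pk.N * (tanOff Pk.ℓs Pk.M + 2) + Pk.N * Pk.d + (Pk.N * KCmax + Rs) ≤ Pk.r₀) (hR : Pk.r₀ ≤ Rπ)
    (hrs : 1 + (Pk.N * (tanOff Pk.ℓs Pk.M + 2) + Pk.N * Pk.d + (Pk.N * KCmax + Rs)) ≤ rs)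
    (hcS : (Pk.N + 1) * (tanOff Pk.ℓs Pk.M + 1) + (Pk.N + 1) * Pk.d + (KCmax + 1) * (Pk.N + 2) + cU ≤ cS)
    (hreach : r + (Pk.N * (tanOff Pk.ℓs Pk.M + 1) + Pk.N * Pk.d + Pk.N * KCmax) ≤ Pk.r₀)
    {Rlev₂ N₂ j₀₂ j₁₂ : ℕ} (hj0 : tanOff Pk.ℓs Pk.M ≤ j₀₂) (hj₂ : j₁₂ ≤ Rlev₂) (hRl₂ : Rlev₂ + 1 ≤ Sc.R')
    (hE : j₁₂ + (Pk.N * (tanOff Pk.ℓs Pk.M + 1) + Pk.N * Pk.d + Pk.N * KCmax) ≤ Sc.R')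
    (kk₂ : ℕ) (hkN₂ : kk₂ * (Δ + 1) ^ (2 * rs) ≤ N₂)
    {D₀ : ℕ} (hc₁ : c₁ ∈ graphBall G t D₀) (hRdepth : ∀ z ∈ Sc.prism, D₀ + M * (kq + 3) * ((z 0).natAbs + (z 1).natAbs) ≤ Rπ)
    -- ROOMS: footprints of the bridge region / the corridor regions / the last core, clearances of the seed, the bridge target nonempty, the cross link
    (hfoot₁ : ∀ w ∈ graphBall G t Rπ, rootFrame φ t σ w ∈ Finset.Icc B.regionLo B.regionHi → RootFootV P du (ψc w))
    (hfoot₂ : ∀ k ≤ Sc.N, ∀ w ∈ graphBall G t Rπ, runX φ c₁ n hs σ₂ w ∈ Sc.region k → RootFootV P du (ψc w))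
    (hclear₁ : (kb : ℤ) < B.B₀lo 0 - B.R' - B.pr)
    (hclear₂ : ∀ k ≤ Sc.N, ∀ w ∈ graphBall G t Rπ, runX φ c₁ n hs σ₂ w ∈ Sc.region k → (kb : ℤ) < rootFrame φ t σ w 0)
    (hTne₁ : (Win G (rootFrame φ t σ) t (Finset.Icc B.core1Lo B.core1Hi) Rπ).Nonempty)
    (hx : ∀ w ∈ graphBall G t Rπ, rootFrame φ t σ w ∈ Finset.Icc B.core1Lo B.core1Hi → runX φ c₁ n hs σ₂ w ∈ ScheduleNP.core Sc 0)
    (hlastf : ∀ w ∈ graphBall G t Rπ, runX φ c₁ n hs σ₂ w ∈ ScheduleNP.core Sc (Sc.N + 1) → TargetFootV P b₀ du (ψc w))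
    -- accuracy; THE HOP (a route input valid for `P_q`) with its prism rows; counts; kit budgets
    {Δ' : ℕ} {δ η : ℝ} (hδ : 0 < δ) (hη : η ≤ δ / 2) {Qp T₀ : Finset V}
    (hlink : 1 - δ < (bondPercolation G q).real (linkIn (↑Qp : Set V) (Λc t kz) T₀))
    (hQπ : ∀ w ∈ Qp, w ∈ graphBall G t Rπ) (hQfoot : ∀ w ∈ Qp, RootFootV P du (ψc w))
    (hT₀ : ∀ w ∈ T₀, w ∈ graphBall G t Rπ ∧ rootFrame φ t σ w ∈ Finset.Icc B.B₀lo B.B₀hi)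
    (hcount₁ : 1 / (1 - (q : ℝ)) ^ (Δ' * N₁) ≤ δ * ((Finset.Icc j₀₁ j₁₁).card : ℝ))
    (hcount₂ : 1 / (1 - (q : ℝ)) ^ (Δ' * N₂) ≤ δ * ((Finset.Icc j₀₂ j₁₂).card : ℝ))
    (hk₁ : (1 - (q : ℝ) ^ (1 + Δ * cSb + cSb * cU)) ^ kk₁ ≤ δ) (hk₂ : (1 - (q : ℝ) ^ (1 + Δ * cS + cS * cU)) ^ kk₂ ≤ δ)
    -- THE ROUTE INPUTS AT EVERY CENTRE: the bridge event at accuracy `δ³` for `P_q`; the corridor's parked-or-routed input for every sub-box law on the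
    -- region windows (for the K-G corridor: `fun hWD => hrouteSW_kgCorr … hWD Λc kz hlong hlongY`)
    (hbridge : ∀ c, 1 - δ ^ 3 < (bondPercolation G q).real (linkIn (↑(Qb c) : Set V) (Λc c kz) (Fb c)))
    (hrouteSW : ∀ {W' : Sym2 V → unitInterval},
      (∀ k ≤ Sc.N, IsSubbox (winGraph G t Rπ) W' q (Win G (runX φ c₁ n hs σ₂) t (Sc.region k) Rπ)) →
      ∀ k ≤ Sc.N, ∀ c : V,
        runX φ c₁ n hs σ₂ c ∈ Finset.Icc (Sc.lo k - ((Sc.R' : ℕ) : Site 2)) (Sc.hi k + ((Sc.R' : ℕ) : Site 2)) → c ∈ graphBall G t (Rπ - r) →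
        c ∈ Win G (runX φ c₁ n hs σ₂) t (ScheduleNP.core Sc (k + 1)) Rπ ∪ rootRim (G := G) t Rπ Pk.r₀ (Win G (runX φ c₁ n hs σ₂) t (Sc.region k) Rπ) ∨
        ∃ Qt Ft : Finset V, Ft ⊆ Win G (runX φ c₁ n hs σ₂) t (ScheduleNP.core Sc (k + 1)) Rπ ∪ rootRim (G := G) t Rπ Pk.r₀ (Win G (runX φ c₁ n hs σ₂) t (Sc.region k) Rπ) ∧
          Qt ⊆ Win G (runX φ c₁ n hs σ₂) t (Sc.region k) Rπ ∧ 1 - δ ^ 3 ≤ (prodBernoulli W').real (linkIn (↑Qt : Set V) (Λc c kz) Ft))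
    -- THE RIM EXCESS DEVICE (N1's `exists_excess_radius_uniform` conclusion at `q`, entrance depth `ρ + 1`, planar diameter `m` in a map `φe`), below both rims;
    -- the planar diameter of the cut world
    {φe : V → Site 2} {m R₁ : ℕ}
    (hR₁ : ∀ R', R₁ ≤ R' → ∀ (Rw : ℕ) (D' B' : Finset V), (∀ d ∈ D', d ∈ graphBall G t Rw) →
      (∀ d ∈ D', ∀ d' ∈ D', φe d - φe d' ∈ box 2 m) → B' ⊆ D' → (∀ a ∈ B', a ∈ graphBall G t (ρ + 1)) →
        (bondPercolation G q).real (Skel.excess G t R' D' B') ≤ η)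
    (hR₁b : R₁ ≤ Rπ - Pb.r₀) (hR₁r : R₁ ≤ Rπ - Pk.r₀)
    (hDm : ∀ d ∈ ((((⟨cellGeomSG₂bV G ψc P t Λ b₀, q, δc⟩ : KSchA V ℕ).U0root du).filter fun y => y ∈ graphBall G t Rπ) \ Λc t kz),
      ∀ d' ∈ ((((⟨cellGeomSG₂bV G ψc P t Λ b₀, q, δc⟩ : KSchA V ℕ).U0root du).filter fun y => y ∈ graphBall G t Rπ) \ Λc t kz), φe d - φe d' ∈ box 2 m) :
    ∃ (c : V) (R₀ : ℕ) (W : Sym2 V → unitInterval) (s : Fin ((B.bridgeFrame hB).N + 1 + Sc.toFrame.N + 1) → KNLevels.TStep (winGraph G c R₀))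
      (T' : Fin ((B.bridgeFrame hB).N + 1 + Sc.toFrame.N + 1) → Finset V) (η' : ℝ),
      (∀ T : Finset V, (prodBernoulli W).real (⋃ t' ∈ T, openConn t t') ≤
        (prodBernoulli (pinW (KNLevels.lattW G q) ↑((⟨cellGeomSG₂bV G ψc P t Λ b₀, q, δc⟩ : KSchA V ℕ).U₀ G)
          ↑((⟨cellGeomSG₂bV G ψc P t Λ b₀, q, δc⟩ : KSchA V ℕ).U₀ G))).real
          (⋃ t' ∈ (↑T : Set V), openConnIn (↑((cellGeomSG₂bV G ψc P t Λ b₀).Q 0 0 ∪ (cellGeomSG₂bV G ψc P t Λ b₀).Ewv 0 0 du) : Set V) t t')) ∧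
      (∀ i : Fin ((B.bridgeFrame hB).N + 1 + Sc.toFrame.N + 1), (s i).L.o = t) ∧
      (∀ i : Fin ((B.bridgeFrame hB).N + 1 + Sc.toFrame.N), T' (Fin.castSucc i) ⊆ (s i.succ).L.X 0) ∧
      (∀ i : Fin ((B.bridgeFrame hB).N + 1 + Sc.toFrame.N + 1), T' i ⊆ (s i).T) ∧
      (∀ i : Fin ((B.bridgeFrame hB).N + 1 + Sc.toFrame.N + 1), (s i).KitsAtF W q Δ' δ) ∧ η' ≤ δ / 2 ∧
      (∀ i : Fin ((B.bridgeFrame hB).N + 1 + Sc.toFrame.N + 1), (prodBernoulli W).real (⋃ t' ∈ (s i).T \ T' i, openConn t t') ≤ η') ∧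
      1 - δ < (prodBernoulli W).real (s 0).L.reachB ∧
      T' (Fin.last ((B.bridgeFrame hB).N + 1 + Sc.toFrame.N)) ⊆ (cellGeomSG₂bV G ψc P t Λ b₀).M 0 ((0 : Site 2) + stepVec du) := by
  set S : KSchA V ℕ := ⟨cellGeomSG₂bV G ψc P t Λ b₀, q, δc⟩ with hSdef
  set A : Finset V := Λc t kz with hAdef
  set U' : Finset V := (S.U0root du).filter fun y => y ∈ graphBall G t Rπ with hU'
  set ψL := runX φ c₁ n hs σ₂ with hψL
  have hlipL : Lip G ψL := lip_runX hlipφ hσ₂ hn c₁ hs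
  set 𝒲₁ := planarWindowWin (lip_rootFrame hlipφ t hσ) t Rπ with h𝒲₁
  set 𝒲₂ := planarWindowWin (lip_runX hlipφ hσ₂ hn c₁ hs) t Rπ with h𝒲₂
  set S₁ := B.bridgeFrame hB with hS₁
  set S₂ : SchedFrame := Sc.toFrame with hS₂
  -- the chain data: rims are the far parts of the region windows
  set P₁ : WinChainData V := ⟨Rlev₁, N₁, j₀₁, j₁₁, t, U', fun k => rootRim (G := G) t Rπ Pb.r₀ (𝒲₁.stepDF S₁ k)⟩ with hP₁
  set P₂ : WinChainData V := ⟨Rlev₂, N₂, j₀₂, j₁₂, t, U', fun k => rootRim (G := G) t Rπ Pk.r₀ (𝒲₂.stepDF S₂ k)⟩ with hP₂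
  have hpq : S.p = q := rfl
  -- seed rows
  have htA : t ∈ A := hcz t
  have hAπ : ∀ a ∈ A, a ∈ graphBall G t Rπ := fun a ha => graphBall_mono G t hρπ (hZρ a ha)
  -- footprints ⟹ the root world
  have hU : ∀ {w : V}, w ∈ graphBall G t Rπ → RootFootV P du (ψc w) → w ∈ U' := by
    intro w hw hf
    exact Finset.mem_filter.2 ⟨mem_U0rootV_of_footprint P t Λ b₀ q δc du hlipc hwsc hRQ hRB hRQ' hw hf.1 hf.2.1 hf.2.2, hw⟩
  have hDU₁ : ∀ k ≤ S₁.N, 𝒲₁.stepDF S₁ k ⊆ U' := by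
    intro k hk w hw
    obtain rfl : k = 0 := Nat.le_zero.1 hk
    change w ∈ Win G (rootFrame φ t σ) t (S₁.region 0) Rπ at hw
    rw [mem_Win] at hw
    exact hU hw.1 (hfoot₁ w hw.1 (by simpa [hS₁] using hw.2))
  have hDU₂ : ∀ k ≤ S₂.N, 𝒲₂.stepDF S₂ k ⊆ U' := by
    intro k hk w hw
    change w ∈ Win G ψL t (S₂.region k) Rπ at hw
    rw [mem_Win] at hw
    exact hU hw.1 (hfoot₂ k hk w hw.1 hw.2)
  have hDA₁ : ∀ k ≤ S₁.N, Disjoint (𝒲₁.stepDF S₁ k) A := by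
    intro k hk
    obtain rfl : k = 0 := Nat.le_zero.1 hk
    change Disjoint (Win G (rootFrame φ t σ) t (S₁.region 0) Rπ) A
    refine Finset.disjoint_left.2 fun w hw hwA => ?_
    rw [mem_Win] at hw
    have h1 : B.B₀lo 0 - B.R' - B.pr ≤ rootFrame φ t σ w 0 := BridgePrm.le_of_mem_region (by simpa [hS₁] using hw.2) 0
    have h2 := (abs_le.1 (hZk w hwA)).2
    linarith
  have hDA₂ : ∀ k ≤ S₂.N, Disjoint (𝒲₂.stepDF S₂ k) A := by
    intro k hk
    change Disjoint (Win G ψL t (S₂.region k) Rπ) A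
    refine Finset.disjoint_left.2 fun w hw hwA => ?_
    rw [mem_Win] at hw
    have h1 := hclear₂ k hk w hw.1 hw.2
    have h2 := (abs_le.1 (hZk w hwA)).2
    linarith
  -- the sub-box weightings of the region windows under the root-seed law
  have hFA : ∀ e ∈ edgesIn G A, ∀ w ∈ e, w ∈ A := fun e he w hw => ((mem_edgesIn_iff).1 he).2 w hw
  have hWD₁ : ∀ k ≤ S₁.N, IsSubbox (winGraph G t Rπ) (S.W0pin G (edgesIn G A) U') S.p (𝒲₁.stepDF S₁ k) := fun k hk =>
    Skel.isSubbox_W0pin_win (S := S) t Rπ (U := S.U0root du) (hDU₁ k hk) (KSchA.fresh_of_disjoint hFA (hDA₁ k hk))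
  have hWD₂ : ∀ k ≤ Sc.N, IsSubbox (winGraph G t Rπ) (S.W0pin G (edgesIn G A) U') q (Win G ψL t (Sc.region k) Rπ) := fun k hk =>
    Skel.isSubbox_W0pin_win (S := S) t Rπ (U := S.U0root du) (hDU₂ k hk) (KSchA.fresh_of_disjoint hFA (hDA₂ k hk))
  -- rim excesses
  have hexc₁ : ∀ k ≤ S₁.N, (prodBernoulli (S.W0pin G (edgesIn G A) U')).real (⋃ t' ∈ P₁.Rim k, openConn t t') ≤ η := fun k hk =>
    real_rootRim_le (S := S) (du := du) htA hZρ (hDU₁ k hk) (hDA₁ k hk) hR₁ hR₁b hDm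
  have hexc₂ : ∀ k ≤ S₂.N, (prodBernoulli (S.W0pin G (edgesIn G A) U')).real (⋃ t' ∈ P₂.Rim k, openConn t t') ≤ η := fun k hk =>
    real_rootRim_le (S := S) (du := du) htA hZρ (hDU₂ k hk) (hDA₂ k hk) hR₁ hR₁r hDm
  -- the corridor's core windows are nonempty: a vertex of the run frame over each core point, within the window ball by the depth row
  have hTne₂ : ∀ k ≤ S₂.N, (Win G ψL t (S₂.core (k + 1)) Rπ).Nonempty := by
    intro k hk
    obtain ⟨z, hz⟩ := Sc.nonempty (k + 1) (by change k ≤ Sc.N at hk; omega)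
    have hzP : z ∈ Sc.prism := Sc.sub_prism k hk (Sc.succ k hk hz)
    obtain ⟨g, hg, hgz⟩ := QStepsN.exists_mem_graphBall_eq (qStepsN_runX_of_qStepsN hqφ hn c₁ hs hσ₂ hκL) c₁ z
    rw [runX_origin] at hg
    simp only [Pi.zero_apply, sub_zero] at hg
    have hgw : g ∈ graphBall G t (D₀ + M * (kq + 3) * ((z 0).natAbs + (z 1).natAbs)) := BoxProdZ2.mem_graphBall_add G hc₁ hg
    have hgR : g ∈ graphBall G t Rπ := graphBall_mono G _ (hRdepth z hzP) hgw
    exact ⟨g, (mem_Win (G := G) (φ := ψL)).2 ⟨hgR, by rw [hψL, hgz]; exact hz⟩⟩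
  -- the kits of the bridge step (hp-8's `hkits_bridgeFC`)
  have hkits₁ : ∀ k ≤ (B.bridgeFrame hB).N, ∀ j ∈ Finset.Icc P₁.j₀ P₁.j₁, ∃ (σk : SData V) (Sz : Finset V),
      SHyp (P₁.stepLF 𝒲₁ (B.bridgeFrame hB) k) j σk ∧ σk.N ≤ P₁.N ∧ (1 - (q : ℝ) ^ σk.sB) ^ σk.k ≤ δ ∧
      Sz ⊆ 𝒲₁.stepDF (B.bridgeFrame hB) k ∧ (∀ x ∈ σk.K, σk.face x ⊆ Sz) ∧
      RelayClause (P₁.stepLF 𝒲₁ (B.bridgeFrame hB) k) (S.W0pin G (edgesIn G A) U') j σk Sz (P₁.coreEF 𝒲₁ (B.bridgeFrame hB) k)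
        (𝒲₁.stepDF (B.bridgeFrame hB) k) δ := by
    intro k hk j hj
    obtain rfl : k = 0 := Nat.le_zero.1 hk
    have hjge : j₀₁ ≤ j := (Finset.mem_Icc.1 hj).1
    have hjle : j ≤ j₁₁ := (Finset.mem_Icc.1 hj).2
    have hXD : winLevel G (rootFrame φ t σ) t Rπ B.B₀lo B.B₀hi j ⊆ 𝒲₁.stepDF S₁ 0 := by
      change Win G (rootFrame φ t σ) t (Finset.Icc (B.B₀lo - (j : Site 2)) (B.B₀hi + (j : Site 2))) Rπ ⊆ Win G (rootFrame φ t σ) t (S₁.region 0) Rπ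
      refine Win_mono G _ ?_ le_rfl
      rw [hS₁, BridgePrm.bridgeFrame_region]
      exact (S₁.icc_enlarge_mono 0 (show j ≤ B.R' by omega)).trans BridgePrm.enl_subset_region
    have hPD : Win G (rootFrame φ t σ) t (Finset.Icc B.regionLo B.regionHi) Rπ ⊆ 𝒲₁.stepDF S₁ 0 := subset_rfl
    have hPT : Win G (rootFrame φ t σ) t (Finset.Icc B.core1Lo B.core1Hi) Rπ ⊆ P₁.coreEF 𝒲₁ S₁ 0 := Finset.subset_union_left
    have hfarT : ∀ v ∈ winLevel G (rootFrame φ t σ) t Rπ B.B₀lo B.B₀hi j, v ∉ graphBall G t (Rπ - Pb.r₀) → v ∈ P₁.coreEF 𝒲₁ S₁ 0 :=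
      fun v hv hfar => Finset.mem_union_right _ (Finset.mem_filter.2 ⟨hXD hv, hfar⟩)
    exact hkits_bridgeFC_q hlipφ hqφ hΔ hδ t hσ B Pb hPNb hAb hdDb hDρb hKCmaxb (hwideb j hjge hjle) (hdwb j hjge hjle) (hDwb j hjge hjle) hTb hr₀b hRb₀ hrsb hcSb
      (le_trans (by omega) hEb) hreachb hrb hrbR Rg hRg hRgcard hcU1 Λc kz hΛRg hzconn hcz Qb Fb hQb hFb kk₁ t U' (hWD₁ 0 le_rfl) hPD hXD hPT
      hfarT hkN₁ hk₁ hbridge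
  -- the kits of the corridor (p5-g16's `hkits_schedFC` fed by the route input under the root-seed law)
  have hj1R : P₂.j₁ ≤ Sc.R' := show j₁₂ ≤ Sc.R' by omega
  have hcover : ∀ k ≤ Sc.N, ∀ v ∈ Win G (runX φ c₁ n hs σ₂) t (Sc.region k) Rπ, v ∉ graphBall G t (Rπ - Pk.r₀) → v ∈ P₂.Rim k :=
    fun k _ v hv hfar => Finset.mem_filter.2 ⟨hv, hfar⟩
  have hkits₂ := hkits_schedFCQ hlipφ hqφ hΔ hδ hn c₁ hs hσ₂ hκL Sc Pk hPN hA hdD hDρ hKCmax hT hr₀ hR hrs hcS hreach Rg hRg hRgcard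
    hcU1 Λc kz hΛRg hzconn hcz P₂ hj0 hj1R hE kk₂ hkN₂ hk₂ hcover (hrouteSW hWD₂)
  -- assemble
  exact rootChainF_of_bridgeV hlipφ hlipc hwsc hlipL P t Λ b₀ q δc du hσ hRQ hRB hRQ' hRM htA (hzconn t) hAπ hZfoot hZk B hB S₂ P₁ P₂ rfl rfl rfl rfl
    (fun k => rootRim_subset t Rπ Pb.r₀ _) (fun k => rootRim_subset t Rπ Pk.r₀ _) hRl₁ hRl₂ hj₁ hj₂ hfoot₁ hfoot₂ hclear₁ hclear₂ hTne₁ hTne₂ hx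
    hlastf hlink hQπ hQfoot hT₀ hcount₁ hcount₂ hkits₁ hkits₂ hη hexc₁ hexc₂

end Skelφ

end Transplant

end Summit.CriticalPhenomena.PercolationContinuityZ3.Theorems

end
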